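import Summits.HodgeConjecture.CorCM.DecicWeil23TripleTwoTransitiveTransfer
import Summits.HodgeConjecture.CorCM.DecicWeil23PairTwoTransitiveFamilyHodgeOfMarkman
import Summits.HodgeConjecture.CorCM.DecicWeil23TripleHodgeOfMarkman
import HarnessLib

/-!
# COR-CM — the Hodge conjecture for every product of copies of `E, B₁, B₂, B₃` (three CM fivefolds of `k`-signature `(2,3)` over
# one DECIC CM field `K ⊇ i(k)`, the CM curve of `k`) and for every family of such fivefolds whose types take at most three values,
# GIVEN ONLY Markman's hyperbolic-sixfold theorem — under `2`-TRANSITIVITY of `Aut(ℂ/k)` on the five embeddings over `τ`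

Cell `pub-hodgecm2` (COR-CM), seat b30 gen 23 (2026-08-22); count-neutral own lane DECIC-2T, part 2 (three types).  Theorems only;
no definition, no named fact, no `sorry`.  HONEST FRAMING: CONDITIONAL on the single displayed named fact
`HodgeTheory.Markman2025_weilClasses_algebraic_hyperbolicSixfold` (E. Markman, arXiv:2502.03415 Thm 1.5.1 — UNREFEREED); `HC_CM`
is not asserted and no case of the Hodge conjecture is claimed unconditionally.

The `2`-TRANSITIVE twins of gen 22's `CorCM/DecicWeil23TriplePowersHodgeOfMarkman` / `…TripleHodgeOfMarkman`: the hypothesis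
«`Aut(ℂ)` `3`-transitive on the five embeddings of `K` over `τ`» (quintic part `A₅`/`S₅`) becomes `2`-TRANSITIVITY (quintic part
`S₅`, `A₅` or the Frobenius group `F₂₀`), through the abstract defect law of `Census/DecicWeil23TripleTwoTransitive` and the
frame transfer `modelBalancedT_of_isGaloisBalancedAlg_h2t`.
* §1 **`hodgeConjectureFor_biproduct_comp_of_frameT_of_markmanSixfold_of_transfer`** (gen 22's assembly over an abstract frame
  transfer `htr`), **`…_h2t`**, and the `AVDominatedBy` form.
* §2 **`hodgeConjectureFor_biproduct_comp_vec_of_markmanT_h2T`** — INTRINSIC: three pairwise distinct `(2,3)`-types over a decic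
  `K ⊇ i(k)` with `2`-transitive quintic part: the Hodge conjecture for every `⨁_j ![E, B₁, B₂, B₃](κ j)`; the family forms
  **`hodgeConjectureFor_of_avDominatedBy_family_of_markmanT_h2T`** (three distinct values) and
  **`hodgeConjectureFor_of_avDominatedBy_family_le₃_of_markmanT_h2T`** (types take AT MOST THREE values — every finite family of
  `(2,3)`-fivefolds over `K` of that kind, `× E^a`, everything dominated); `…biproduct_family_le₃…` (no curve factor).
[cite: Markman2025SecantWeil, Thm 1.5.1] [cite: Pohlmann1968, Thm 1] [cite: Milne2020HodgeClassesAV, 1.2 (a) and Thm. 1]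
[cite: Schoen1998HodgeWeilAddendum, §10] [cite: Shimura1998, §6.1 Thm. 2 Cor.] [cite: DixonMortimer1996, §2.1]

## References
* [Markman2025SecantWeil] E. Markman, arXiv:2502.03415 (unrefereed), Thm 1.5.1.  [Pohlmann1968] H. Pohlmann, Ann. of Math. 88
  (1968), Thm 1.  [Milne2020HodgeClassesAV] J. S. Milne, arXiv:2010.08857, 1.2 (a), Thm. 1.  [Schoen1998HodgeWeilAddendum]
  C. Schoen, Compositio Math. 114 (1998), §10.  [Shimura1998] G. Shimura, *Abelian varieties with CM and modular functions*, §6.1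
  Thm. 2 Cor.  [DixonMortimer1996] J. D. Dixon, B. Mortimer, GTM 163 (1996), §2.1.  [MumfordAV1970] D. Mumford, *Abelian
  Varieties*, §19.
-/

noncomputable section

open CategoryTheory CategoryTheory.Limits NumberField

namespace Summit.HodgeConjecture.CorCM.DecicWeil23Triple

open Literature.AlgebraicGeometry Literature.AlgebraicGeometry.Motives Literature.AlgebraicGeometry.HodgeTheory
open Literature.AlgebraicGeometry.ComplexMultiplication (IsCMTypeRealisation)
open Literature.AlgebraicGeometry.Pohlmann1968
open Literature.AlgebraicTopology.SingularHomology
open Literature.NumberTheory.ComplexMultiplication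
open Summit.HodgeConjecture.CorCM.Census.DecicWeil23Triple (PtT inPosT ModelBalancedT IsPairPartT IsSixPartT IsTenPartT
  modelBalancedT_induction)
open Summit.HodgeConjecture.CorCM.DecicWeil23Pair (h2t_of_twoTransitive avDominatedBy_of_cmType_eq
  hodgeConjectureFor_of_avDominatedBy_family₁_of_markmanD_h2T hodgeConjectureFor_of_avDominatedBy_family_of_markmanD_h2T)
open Summit.HodgeConjecture.CorCM.OcticWeilOrbit (orbitSlots)
open Summit.HodgeConjecture.CorCM.OcticCurveFourfold (exists_delta_of_mem)
open Summit.HodgeConjecture.CorCM.Domination (AVDominatedBy)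
open Summit.HodgeConjecture.CorCM.AndreRiemann (sumFam avDominatedBy_prod_of_biproduct avDominatedBy_biproduct_reindex)
open Summit.HodgeConjecture.CorCM.PairWeights

open scoped Classical Pointwise

/-! ## §1 The frame form: assembly over an abstract frame transfer; `2`-transitivity -/

section Assembly

variable {I : Type} {Kf : I → Type} [∀ i, Field (Kf i)] [∀ i, NumberField (Kf i)] [∀ i, IsCMField (Kf i)]
  {i₀ i₁ : I} {τ : Kf i₀ →+* ℂ} {e : (Kf i₁ →+* ℂ) ≃ Fin 5 × Bool} {i : Kf i₀ →+* Kf i₁} {c : Fin 8}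
  {A₄ : Fin 4 → AbelianVariety ℂ} {Φ₄ : ∀ j : Fin 4, CMType (Kf (orbitSlots i₀ i₁ j))}
  {ι₄ : ∀ j, 𝓞 (Kf (orbitSlots i₀ i₁ j)) →+* End (A₄ j)}
  {θ₄ : ∀ j, Kf (orbitSlots i₀ i₁ j) →+* Module.End ℂ (complexBetti (A₄ j).X 1)}

/-- **ASSEMBLY OVER AN ABSTRACT FRAME TRANSFER** (three types): gen 22's
`hodgeConjectureFor_biproduct_comp_of_frameT_of_markmanSixfold` with its Galois input isolated — the Hodge conjecture for
`⨁_j A₄(κ j)` follows from Markman's sixfold theorem as soon as every `Aut(ℂ)`-balanced weight of `⨁_j A₄(κ j)` is a balanced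
configuration of the kernel census `Census/DecicWeil23Triple` (`htr`). [cite: Markman2025SecantWeil, Thm 1.5.1] [cite: Pohlmann1968, Thm 1]
[cite: Milne2020HodgeClassesAV, 1.2 (a) and Thm. 1] [cite: Schoen1998HodgeWeilAddendum, §10] -/
theorem hodgeConjectureFor_biproduct_comp_of_frameT_of_markmanSixfold_of_transfer
    (hM6 : Markman2025_weilClasses_algebraic_hyperbolicSixfold)
    {N : ℕ} (κ : Fin N → Fin 4) (h10 : Module.finrank ℚ (Kf i₁) = 10) (h2 : Module.finrank ℚ (Kf i₀) = 2) (i : Kf i₀ →+* Kf i₁)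
    {δ : 𝓞 (Kf i₀)} {d : ℕ} (hd : 0 < d) (hδ : ((δ : Kf i₀)) ^ 2 = -(d : Kf i₀))
    (hτ : τ (δ : Kf i₀) = Complex.I * (Real.sqrt d : ℂ))
    (hA : ∀ j, IsCMTypeRealisation (Φ₄ j) (A₄ j) (ι₄ j) (θ₄ j))
    (e : (Kf i₁ →+* ℂ) ≃ Fin 5 × Bool)
    (he_sign : ∀ s : Kf i₁ →+* ℂ, (e s).2 = true ↔ s.comp i = τ)
    (he_conj : ∀ s : Kf i₁ →+* ℂ, e (ComplexEmbedding.conjugate s) = ((e s).1, !(e s).2))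
    (hΦ : ∀ (m : Fin 3) (s : Kf i₁ →+* ℂ), s ∈ (Φ₄ m.succ).1 ↔ (e s).2 = inPosT c m (e s).1)
    (hΨ : ∀ σ : Kf i₀ →+* ℂ, σ ∈ (Φ₄ 0).1 ↔ σ = τ)
    (htr : ∀ S : Finset ((j : Fin N) × (Kf (orbitSlots i₀ i₁ (κ j)) →+* ℂ)),
      IsGaloisBalancedAlg (K := fun j => Kf (orbitSlots i₀ i₁ (κ j))) (fun j => Φ₄ (κ j)) S →
      ModelBalancedT c (fun x => toPtT e τ ((Sigma.map κ (fun _ => id) :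
        ((j : Fin N) × (Kf (orbitSlots i₀ i₁ (κ j)) →+* ℂ)) → ((m : Fin 4) × (Kf (orbitSlots i₀ i₁ m) →+* ℂ))) x)) S) :
    HodgeConjectureFor (⨁ fun j => A₄ (κ j)).dim (⨁ fun j => A₄ (κ j)).X := by
  have hττ : ComplexEmbedding.conjugate τ ≠ τ := QuarticCM.conjugate_ne τ
  have hk : ∀ σ : Kf i₀ →+* ℂ, σ = τ ∨ σ = ComplexEmbedding.conjugate τ := fun σ =>
    QuarticCM.eq_or_eq_conjugate_of_quadratic h2 τ σ
  have hW := weilClassesOf_sixfold_le_algebraicClasses_of_frameT_of_markmanSixfold hM6 h10 h2 i hd hδ hA he_sign hΦ hΨ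
  have hsix : ∀ {N' : ℕ} (κ' : Fin N' → Fin 4) (m : Fin 3) (c' : Bool)
      (G' : Finset ((j : Fin N') × (Kf (orbitSlots i₀ i₁ (κ' j)) →+* ℂ))),
      IsSixPartT (fun x => toPtT e τ ((Sigma.map κ' (fun _ => id) :
        ((j : Fin N') × (Kf (orbitSlots i₀ i₁ (κ' j)) →+* ℂ)) → ((l : Fin 4) × (Kf (orbitSlots i₀ i₁ l) →+* ℂ))) x)) m c' G' →
      G'.card = 2 * 3 ∧ weightClassesAlg (fun j => A₄ (κ' j)) (fun j => ι₄ (κ' j)) (2 * 3) G' ≤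
        algebraicClasses (⨁ fun j => A₄ (κ' j)).X 3 :=
    fun κ' m c' G' hG' => weightClassesAlg_le_algebraicClasses_of_isSixPartT hk he_sign hA hτ hW κ' hG'
  refine ⟨nonempty_hodgeModel_holds (Motives.AbelianVariety.isSmoothProjective_holds (A := ⨁ fun j => A₄ (κ j))),
    fun p cl hc hH => ?_⟩
  have hAκ : ∀ j, IsCMTypeRealisation (Φ₄ (κ j)) (A₄ (κ j)) (ι₄ (κ j)) (θ₄ (κ j)) := fun j => hA (κ j)
  have key : ∀ (R : Finset ((j : Fin N) × (Kf (orbitSlots i₀ i₁ (κ j)) →+* ℂ))),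
      ModelBalancedT c (fun x => toPtT e τ ((Sigma.map κ (fun _ => id) :
        ((j : Fin N) × (Kf (orbitSlots i₀ i₁ (κ j)) →+* ℂ)) → ((m : Fin 4) × (Kf (orbitSlots i₀ i₁ m) →+* ℂ))) x)) R →
      ∀ q, R.card = 2 * q → weightClassesAlg (fun j => A₄ (κ j)) (fun j => ι₄ (κ j)) (2 * q) R ≤
        algebraicClasses (⨁ fun j => A₄ (κ j)).X q := by
    intro R hR
    refine modelBalancedT_induction (motive := fun R => ∀ q, R.card = 2 * q →
      weightClassesAlg (fun j => A₄ (κ j)) (fun j => ι₄ (κ j)) (2 * q) R ≤ algebraicClasses (⨁ fun j => A₄ (κ j)).X q)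
      (fun q hq => ?_) (fun G R hGR hG ih q hq => ?_) (fun G R m b hGR hG ih q hq => ?_)
      (fun G R m₁ m₂ hGR hG ih q hq => ?_) hR
    · obtain rfl : q = 0 := by simpa using hq.symm
      exact fun c' _ => hodgeConjectureFor_codim_zero c'
    · obtain ⟨ha, hGalg⟩ := weightClassesAlg_le_algebraicClasses_of_isPairPartT κ hττ hk he_conj hA hG
      have hRcard : R.card = 2 * (q - 1) := by
        have h := Finset.card_union_of_disjoint hGR; rw [hq, ha] at h; omega
      have haq : 1 + (q - 1) = q := by
        have h := Finset.card_union_of_disjoint hGR; rw [hq, ha] at h; omega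
      rw [← Finset.disjUnion_eq_union G R hGR]
      exact weightClassesAlg_union_le_algebraicClasses hAκ haq ha hRcard hGR hGalg (ih (q - 1) hRcard)
    · obtain ⟨ha, hGalg⟩ := hsix κ m b G hG
      have hRcard : R.card = 2 * (q - 3) := by
        have h := Finset.card_union_of_disjoint hGR; rw [hq, ha] at h; omega
      have haq : 3 + (q - 3) = q := by
        have h := Finset.card_union_of_disjoint hGR; rw [hq, ha] at h; omega
      rw [← Finset.disjUnion_eq_union G R hGR]
      exact weightClassesAlg_union_le_algebraicClasses hAκ haq ha hRcard hGR hGalg (ih (q - 3) hRcard)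
    · obtain ⟨ha, hGalg⟩ := weightClassesAlg_le_algebraicClasses_of_isTenPartT κ hττ hk he_conj hA
        (fun m c' G' hG' => (hsix (extT₂ κ) m c' G' hG').2) hG
      have hRcard : R.card = 2 * (q - 5) := by
        have h := Finset.card_union_of_disjoint hGR; rw [hq, ha] at h; omega
      have haq : 5 + (q - 5) = q := by
        have h := Finset.card_union_of_disjoint hGR; rw [hq, ha] at h; omega
      rw [← Finset.disjUnion_eq_union G R hGR]
      exact weightClassesAlg_union_le_algebraicClasses hAκ haq ha hRcard hGR hGalg (ih (q - 5) hRcard)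
  have hmem : cl ∈ ⨆ S ∈ pohlmannSetsAlg (K := fun j => Kf (orbitSlots i₀ i₁ (κ j))) (fun j => Φ₄ (κ j)) p,
      weightClassesAlg (fun j => A₄ (κ j)) (fun j => ι₄ (κ j)) (2 * p) S := by
    rw [← (Pohlmann1968_thm1_cmAlgebra (fun j => Kf (orbitSlots i₀ i₁ (κ j))) (fun j => A₄ (κ j))
      (fun j => Φ₄ (κ j)) (fun j => ι₄ (κ j)) (fun j => θ₄ (κ j)) hAκ p).1]
    exact Submodule.subset_span ⟨hc, hH⟩
  have hle : (⨆ S ∈ pohlmannSetsAlg (K := fun j => Kf (orbitSlots i₀ i₁ (κ j))) (fun j => Φ₄ (κ j)) p,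
      weightClassesAlg (fun j => A₄ (κ j)) (fun j => ι₄ (κ j)) (2 * p) S) ≤
      algebraicClasses (⨁ fun j => A₄ (κ j)).X p := by
    refine iSup₂_le fun S hS => ?_
    exact key S (htr S hS.2) p hS.1
  exact hle hmem

/-- **MAIN THEOREM (frame form, three types, `2`-TRANSITIVITY).  The Hodge conjecture for every product of copies
`⨁_j A₄(κ j)` of `E, B₁, B₂, B₃` — all `E^a × B₁^{n₁} × B₂^{n₂} × B₃^{n₃}` — GIVEN ONLY Markman's hyperbolic-sixfold theorem**, the
three `(2,3)`-types read at the positions of a shape `c`, the conjugate pairs permuted `2`-TRANSITIVELY by `Aut(ℂ)` (`h2t`).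
Leaf: the Markman fact ONLY. [cite: Markman2025SecantWeil, Thm 1.5.1] [cite: Pohlmann1968, Thm 1] [cite: DixonMortimer1996, §2.1] -/
theorem hodgeConjectureFor_biproduct_comp_of_frameT_of_markmanSixfold_h2t
    (hM6 : Markman2025_weilClasses_algebraic_hyperbolicSixfold)
    {N : ℕ} (κ : Fin N → Fin 4) (h10 : Module.finrank ℚ (Kf i₁) = 10) (h2 : Module.finrank ℚ (Kf i₀) = 2) (i : Kf i₀ →+* Kf i₁)
    {δ : 𝓞 (Kf i₀)} {d : ℕ} (hd : 0 < d) (hδ : ((δ : Kf i₀)) ^ 2 = -(d : Kf i₀))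
    (hτ : τ (δ : Kf i₀) = Complex.I * (Real.sqrt d : ℂ))
    (hA : ∀ j, IsCMTypeRealisation (Φ₄ j) (A₄ j) (ι₄ j) (θ₄ j))
    (e : (Kf i₁ →+* ℂ) ≃ Fin 5 × Bool)
    (he_sign : ∀ s : Kf i₁ →+* ℂ, (e s).2 = true ↔ s.comp i = τ)
    (he_conj : ∀ s : Kf i₁ →+* ℂ, e (ComplexEmbedding.conjugate s) = ((e s).1, !(e s).2))
    (hΦ : ∀ (m : Fin 3) (s : Kf i₁ →+* ℂ), s ∈ (Φ₄ m.succ).1 ↔ (e s).2 = inPosT c m (e s).1)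
    (hΨ : ∀ σ : Kf i₀ →+* ℂ, σ ∈ (Φ₄ 0).1 ↔ σ = τ)
    (h2t : ∀ a b : Fin 5, a ≠ b → ∃ ρ : ℂ ≃+* ℂ,
      (ρ : ℂ →+* ℂ).comp (e.symm (a, true)) = e.symm (0, true) ∧ (ρ : ℂ →+* ℂ).comp (e.symm (b, true)) = e.symm (1, true)) :
    HodgeConjectureFor (⨁ fun j => A₄ (κ j)).dim (⨁ fun j => A₄ (κ j)).X :=
  hodgeConjectureFor_biproduct_comp_of_frameT_of_markmanSixfold_of_transfer hM6 κ h10 h2 i hd hδ hτ hA e he_sign he_conj hΦ hΨ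
    fun _ hS => modelBalancedT_of_isGaloisBalancedAlg_h2t (QuarticCM.conjugate_ne τ)
      (fun σ => QuarticCM.eq_or_eq_conjugate_of_quadratic h2 τ σ) he_sign he_conj hΦ hΨ κ h2t hS

/-- **The Hodge conjecture for every abelian variety dominated by a product of copies `⨁_j A₄(κ j)`** (frame form, three types,
`2`-transitivity, modulo Markman's sixfold theorem). [cite: Markman2025SecantWeil, Thm 1.5.1] [cite: MumfordAV1970, §19] -/
theorem hodgeConjectureFor_of_avDominatedBy_comp_of_frameT_of_markmanSixfold_h2t
    (hM6 : Markman2025_weilClasses_algebraic_hyperbolicSixfold)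
    {N : ℕ} (κ : Fin N → Fin 4) (h10 : Module.finrank ℚ (Kf i₁) = 10) (h2 : Module.finrank ℚ (Kf i₀) = 2) (i : Kf i₀ →+* Kf i₁)
    {δ : 𝓞 (Kf i₀)} {d : ℕ} (hd : 0 < d) (hδ : ((δ : Kf i₀)) ^ 2 = -(d : Kf i₀))
    (hτ : τ (δ : Kf i₀) = Complex.I * (Real.sqrt d : ℂ))
    (hA : ∀ j, IsCMTypeRealisation (Φ₄ j) (A₄ j) (ι₄ j) (θ₄ j))
    (e : (Kf i₁ →+* ℂ) ≃ Fin 5 × Bool)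
    (he_sign : ∀ s : Kf i₁ →+* ℂ, (e s).2 = true ↔ s.comp i = τ)
    (he_conj : ∀ s : Kf i₁ →+* ℂ, e (ComplexEmbedding.conjugate s) = ((e s).1, !(e s).2))
    (hΦ : ∀ (m : Fin 3) (s : Kf i₁ →+* ℂ), s ∈ (Φ₄ m.succ).1 ↔ (e s).2 = inPosT c m (e s).1)
    (hΨ : ∀ σ : Kf i₀ →+* ℂ, σ ∈ (Φ₄ 0).1 ↔ σ = τ)
    (h2t : ∀ a b : Fin 5, a ≠ b → ∃ ρ : ℂ ≃+* ℂ,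
      (ρ : ℂ →+* ℂ).comp (e.symm (a, true)) = e.symm (0, true) ∧ (ρ : ℂ →+* ℂ).comp (e.symm (b, true)) = e.symm (1, true))
    {X : AbelianVariety ℂ} (hX : AVDominatedBy X (⨁ fun j => A₄ (κ j))) :
    HodgeConjectureFor X.dim X.X :=
  Domination.hodgeConjectureFor_of_avDominatedBy
    (hodgeConjectureFor_biproduct_comp_of_frameT_of_markmanSixfold_h2t hM6 κ h10 h2 i hd hδ hτ hA e he_sign he_conj hΦ hΨ
      h2t) hX

end Assembly

/-! ## §2 The intrinsic theorem and the family forms under `2`-transitivity -/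

section Main

variable {K : Type} [Field K] [NumberField K] [IsCMField K] {k : Type} [Field k] [NumberField k] [IsCMField k] {N : ℕ}
  {Φ₁ Φ₂ Φ₃ : CMType K} {B₁ B₂ B₃ : AbelianVariety ℂ}
  {ι₁ : 𝓞 K →+* End B₁} {θ₁ : K →+* Module.End ℂ (complexBetti B₁.X 1)}
  {ι₂ : 𝓞 K →+* End B₂} {θ₂ : K →+* Module.End ℂ (complexBetti B₂.X 1)}
  {ι₃ : 𝓞 K →+* End B₃} {θ₃ : K →+* Module.End ℂ (complexBetti B₃.X 1)}
  {Ψ : CMType k} {E : AbelianVariety ℂ} {ιE : 𝓞 k →+* End E} {θE : k →+* Module.End ℂ (complexBetti E.X 1)}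

/-- **THE HODGE CONJECTURE FOR EVERY PRODUCT OF COPIES OF `E, B₁, B₂, B₃`, GIVEN ONLY Markman's hyperbolic-sixfold theorem —
`2`-TRANSITIVE form.**  `B_l ⊨ (K; Φ_l)` CM abelian FIVEFOLDS with CM by one field `K ⊇ i(k)` of degree `10`, of `k`-signature
`(2,3)` and PAIRWISE DIFFERENT types, `E ⊨ (k; Ψ ∋ τ)`, and `Aut(ℂ)` `2`-TRANSITIVE on the five embeddings of `K` over `τ` (`h2T`;
quintic part `S₅`, `A₅` or `F₂₀`): for every `κ : Fin N → Fin 4`, every rational `(q,q)`-class on `⨁_j ![E, B₁, B₂, B₃] (κ j)` is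
algebraic. [cite: Markman2025SecantWeil, Thm 1.5.1] [cite: Pohlmann1968, Thm 1] [cite: Schoen1998HodgeWeilAddendum, §10]
[cite: DixonMortimer1996, §2.1] -/
theorem hodgeConjectureFor_biproduct_comp_vec_of_markmanT_h2T
    (hM6 : Markman2025_weilClasses_algebraic_hyperbolicSixfold)
    (h10 : Module.finrank ℚ K = 10) (h2 : Module.finrank ℚ k = 2) (i : k →+* K)
    (hB₁ : IsCMTypeRealisation Φ₁ B₁ ι₁ θ₁) (hB₂ : IsCMTypeRealisation Φ₂ B₂ ι₂ θ₂) (hB₃ : IsCMTypeRealisation Φ₃ B₃ ι₃ θ₃)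
    (hE : IsCMTypeRealisation Ψ E ιE θE) {τ : k →+* ℂ} (hτΨ : τ ∈ Ψ.1)
    (h23₁ : (Finset.univ.filter fun s : K →+* ℂ => s.comp i = τ ∧ s ∈ Φ₁.1).card = 2)
    (h23₂ : (Finset.univ.filter fun s : K →+* ℂ => s.comp i = τ ∧ s ∈ Φ₂.1).card = 2)
    (h23₃ : (Finset.univ.filter fun s : K →+* ℂ => s.comp i = τ ∧ s ∈ Φ₃.1).card = 2)
    (h₁₂ : Φ₁ ≠ Φ₂) (h₁₃ : Φ₁ ≠ Φ₃) (h₂₃ : Φ₂ ≠ Φ₃)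
    (h2T : ∀ x y : Fin 2 ↪ {s : K →+* ℂ // s.comp i = τ}, ∃ ρ : ℂ ≃+* ℂ, ∀ j : Fin 2, (ρ : ℂ →+* ℂ).comp (x j).1 = (y j).1)
    (κ : Fin N → Fin 4) :
    HodgeConjectureFor (⨁ fun j => (![E, B₁, B₂, B₃] : Fin 4 → AbelianVariety ℂ) (κ j)).dim
      (⨁ fun j => (![E, B₁, B₂, B₃] : Fin 4 → AbelianVariety ℂ) (κ j)).X := by
  have hττ : ComplexEmbedding.conjugate τ ≠ τ := QuarticCM.conjugate_ne τ
  have hk : ∀ σ : k →+* ℂ, σ = τ ∨ σ = ComplexEmbedding.conjugate τ := fun σ =>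
    QuarticCM.eq_or_eq_conjugate_of_quadratic h2 τ σ
  have hΨ : ∀ σ : k →+* ℂ, σ ∈ Ψ.1 ↔ σ = τ := by
    intro σ
    rcases hk σ with rfl | rfl
    · exact ⟨fun _ => rfl, fun _ => hτΨ⟩
    · exact ⟨fun h => absurd h ((Ψ.2 τ).1 hτΨ), fun h => absurd h hττ⟩
  obtain ⟨δ₀, d, hd, hδ₀⟩ := CyclicSextic.exists_sq_eq_neg_nat_of_isTotallyComplex k h2
  obtain ⟨δ, hδ, hτ⟩ := exists_delta_of_mem h2 hd hδ₀ τ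
  obtain ⟨e, c, he_sign, he_conj, hr₁, hr₂, hr₃⟩ := exists_frameT h10 h2 i hττ hk Φ₁ Φ₂ Φ₃ h23₁ h23₂ h23₃ h₁₂ h₁₃ h₂₃
  have h2t := h2t_of_twoTransitive he_sign h2T
  let Kf : Fin 2 → Type := Fin.cons k fun _ : Fin 1 => K
  letI instF : ∀ j, Field (Kf j) := fun j =>
    Fin.cases (motive := fun j => Field (Kf j)) ‹Field k› (fun _ => ‹Field K›) j
  letI instN : ∀ j, NumberField (Kf j) := fun j =>
    Fin.cases (motive := fun j => NumberField (Kf j)) ‹NumberField k› (fun _ => ‹NumberField K›) j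
  haveI instC : ∀ j, IsCMField (Kf j) := fun j =>
    Fin.cases (motive := fun j => IsCMField (Kf j)) ‹IsCMField k› (fun _ => ‹IsCMField K›) j
  exact hodgeConjectureFor_biproduct_comp_of_frameT_of_markmanSixfold_h2t (Kf := Kf) (i₀ := 0) (i₁ := 1) (c := c)
    (A₄ := ![E, B₁, B₂, B₃])
    (Φ₄ := Fin.cons Ψ (Fin.cons Φ₁ (Fin.cons Φ₂ (Fin.cons Φ₃ finZeroElim))))
    (ι₄ := Fin.cons ιE (Fin.cons ι₁ (Fin.cons ι₂ (Fin.cons ι₃ finZeroElim))))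
    (θ₄ := Fin.cons θE (Fin.cons θ₁ (Fin.cons θ₂ (Fin.cons θ₃ finZeroElim)))) hM6 κ h10 h2 i hd hδ hτ
    (Fin.cases hE (Fin.cases hB₁ (Fin.cases hB₂ (Fin.cases hB₃ fun l => l.elim0)))) e he_sign he_conj
    (Fin.cases hr₁ (Fin.cases hr₂ (Fin.cases hr₃ fun l => l.elim0))) hΨ h2t

variable {n : ℕ} {Φ : Fin n → CMType K} {A : Fin n → AbelianVariety ℂ} {ι : ∀ j, 𝓞 K →+* End (A j)}
  {θ : ∀ j, K →+* Module.End ℂ (complexBetti (A j).X 1)}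

/-- **THE FAMILY FORM (three distinct values, `2`-transitive).**  `A_j ⊨ (K; Φ_j)` (`j < n`) CM abelian fivefolds, each `Φ_j`
one of THREE pairwise distinct types `Φ_{j₁}, Φ_{j₂}, Φ_{j₃}` of `k`-signature `(2,3)`; `K ⊇ i(k)` decic with `Aut(ℂ)`
`2`-transitive over `τ`; `E ⊨ (k; Ψ ∋ τ)`: every `C` dominated by `E^a × ⨁_j A_j` satisfies the Hodge conjecture, GIVEN ONLY
Markman's hyperbolic-sixfold theorem. [cite: Markman2025SecantWeil, Thm 1.5.1] [cite: Shimura1998, §6.1 Thm. 2 Cor.]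
[cite: MumfordAV1970, §19] -/
theorem hodgeConjectureFor_of_avDominatedBy_family_of_markmanT_h2T
    (hM6 : Markman2025_weilClasses_algebraic_hyperbolicSixfold)
    (h10 : Module.finrank ℚ K = 10) (h2 : Module.finrank ℚ k = 2) (i : k →+* K)
    (hA : ∀ j, IsCMTypeRealisation (Φ j) (A j) (ι j) (θ j)) {τ : k →+* ℂ} (j₁ j₂ j₃ : Fin n)
    (h23₁ : (Finset.univ.filter fun s : K →+* ℂ => s.comp i = τ ∧ s ∈ (Φ j₁).1).card = 2)
    (h23₂ : (Finset.univ.filter fun s : K →+* ℂ => s.comp i = τ ∧ s ∈ (Φ j₂).1).card = 2)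
    (h23₃ : (Finset.univ.filter fun s : K →+* ℂ => s.comp i = τ ∧ s ∈ (Φ j₃).1).card = 2)
    (h₁₂ : Φ j₁ ≠ Φ j₂) (h₁₃ : Φ j₁ ≠ Φ j₃) (h₂₃ : Φ j₂ ≠ Φ j₃) (hpos : ∀ j, Φ j = Φ j₁ ∨ Φ j = Φ j₂ ∨ Φ j = Φ j₃)
    (h2T : ∀ x y : Fin 2 ↪ {s : K →+* ℂ // s.comp i = τ}, ∃ ρ : ℂ ≃+* ℂ, ∀ l : Fin 2, (ρ : ℂ →+* ℂ).comp (x l).1 = (y l).1)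
    (hE : IsCMTypeRealisation Ψ E ιE θE) (hτΨ : τ ∈ Ψ.1) (a : ℕ)
    {C : AbelianVariety ℂ} (hC : AVDominatedBy C ((⨁ fun _ : Fin a => E).prod (⨁ A))) :
    HodgeConjectureFor C.dim C.X := by
  let Bv : Fin 3 → AbelianVariety ℂ := ![A j₁, A j₂, A j₃]
  have hdomB : ∀ j, ∃ m : Fin 3, AVDominatedBy (A j) (Bv m) := by
    intro j
    rcases hpos j with h | h | h
    · exact ⟨0, avDominatedBy_of_cmType_eq h (hA j) (hA j₁)⟩
    · exact ⟨1, avDominatedBy_of_cmType_eq h (hA j) (hA j₂)⟩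
    · exact ⟨2, avDominatedBy_of_cmType_eq h (hA j) (hA j₃)⟩
  choose m hm using hdomB
  let Y : Fin 4 → AbelianVariety ℂ := ![E, A j₁, A j₂, A j₃]
  have hYsucc : ∀ m : Fin 3, Y m.succ = Bv m := fun m => rfl
  have hd₁ : AVDominatedBy (⨁ fun _ : Fin a => E) (⨁ fun _ : Fin a => Y 0) :=
    AVDominatedBy.biproduct_map fun _ => AVDominatedBy.refl E
  have hd₂ : AVDominatedBy (⨁ A) (⨁ fun j => Y (m j).succ) :=
    AVDominatedBy.biproduct_map fun j => by rw [hYsucc]; exact hm j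
  have h₁₂' := avDominatedBy_prod_of_biproduct hd₁ hd₂
  let κ' : Fin a ⊕ Fin n → Fin 4 := Sum.elim (fun _ => 0) fun j => (m j).succ
  have hfam : sumFam (fun _ : Fin a => Y 0) (fun j => Y (m j).succ) = Y ∘ κ' := funext fun x => by
    cases x <;> rfl
  rw [hfam] at h₁₂'
  have hdom := avDominatedBy_biproduct_reindex finSumFinEquiv.symm h₁₂'
  exact Domination.hodgeConjectureFor_of_avDominatedBy
    (hodgeConjectureFor_biproduct_comp_vec_of_markmanT_h2T hM6 h10 h2 i (hA j₁) (hA j₂) (hA j₃) hE hτΨ h23₁ h23₂ h23₃ h₁₂ h₁₃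
      h₂₃ h2T (κ' ∘ finSumFinEquiv.symm)) (hC.trans hdom)

/-- **THE FAMILY FORM WITHOUT DISTINCTNESS (`2`-transitive): the `(2,3)`-types take AT MOST THREE values.**  `K ⊇ i(k)` ANY CM
field of degree `10` over the imaginary quadratic `k` whose five embeddings over `τ` are permuted `2`-TRANSITIVELY by `Aut(ℂ)`
(quintic part `S₅`, `A₅` or `F₂₀`); `A_j ⊨ (K; Φ_j)` (`j < n`) CM abelian fivefolds of `k`-signature `(2,3)` whose types all lie in
`{Φ_{j₁}, Φ_{j₂}, Φ_{j₃}}` (coincidences allowed); `E ⊨ (k; Ψ ∋ τ)`.  Then every `C` dominated by `E^a × ⨁_j A_j` satisfies the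
Hodge conjecture, GIVEN ONLY Markman's hyperbolic-sixfold theorem (cases: one, two or three values).  Supersedes gen 22's
`hodgeConjectureFor_of_avDominatedBy_family_le₃_of_markmanT` (`3`-transitivity).  FOUR values can fail (exact census).
[cite: Markman2025SecantWeil, Thm 1.5.1] [cite: Shimura1998, §6.1 Thm. 2 Cor.] [cite: MumfordAV1970, §19] -/
theorem hodgeConjectureFor_of_avDominatedBy_family_le₃_of_markmanT_h2T
    (hM6 : Markman2025_weilClasses_algebraic_hyperbolicSixfold)
    (h10 : Module.finrank ℚ K = 10) (h2 : Module.finrank ℚ k = 2) (i : k →+* K)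
    (hA : ∀ j, IsCMTypeRealisation (Φ j) (A j) (ι j) (θ j)) {τ : k →+* ℂ} (j₁ j₂ j₃ : Fin n)
    (h23₁ : (Finset.univ.filter fun s : K →+* ℂ => s.comp i = τ ∧ s ∈ (Φ j₁).1).card = 2)
    (h23₂ : (Finset.univ.filter fun s : K →+* ℂ => s.comp i = τ ∧ s ∈ (Φ j₂).1).card = 2)
    (h23₃ : (Finset.univ.filter fun s : K →+* ℂ => s.comp i = τ ∧ s ∈ (Φ j₃).1).card = 2)
    (hpos : ∀ j, Φ j = Φ j₁ ∨ Φ j = Φ j₂ ∨ Φ j = Φ j₃)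
    (h2T : ∀ x y : Fin 2 ↪ {s : K →+* ℂ // s.comp i = τ}, ∃ ρ : ℂ ≃+* ℂ, ∀ l : Fin 2, (ρ : ℂ →+* ℂ).comp (x l).1 = (y l).1)
    (hE : IsCMTypeRealisation Ψ E ιE θE) (hτΨ : τ ∈ Ψ.1) (a : ℕ)
    {C : AbelianVariety ℂ} (hC : AVDominatedBy C ((⨁ fun _ : Fin a => E).prod (⨁ A))) :
    HodgeConjectureFor C.dim C.X := by
  by_cases h₁₂ : Φ j₁ = Φ j₂
  · by_cases h₁₃ : Φ j₁ = Φ j₃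
    · refine hodgeConjectureFor_of_avDominatedBy_family₁_of_markmanD_h2T hM6 h10 h2 i hA j₁ h23₁ (fun j => ?_) h2T hE hτΨ
        a hC
      rcases hpos j with h | h | h
      exacts [h, h.trans h₁₂.symm, h.trans h₁₃.symm]
    · refine hodgeConjectureFor_of_avDominatedBy_family_of_markmanD_h2T hM6 h10 h2 i hA j₁ j₃ h23₁ h23₃ h₁₃ (fun j => ?_)
        h2T hE hτΨ a hC
      rcases hpos j with h | h | h
      exacts [Or.inl h, Or.inl (h.trans h₁₂.symm), Or.inr h]
  · by_cases h₁₃ : Φ j₁ = Φ j₃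
    · refine hodgeConjectureFor_of_avDominatedBy_family_of_markmanD_h2T hM6 h10 h2 i hA j₁ j₂ h23₁ h23₂ h₁₂ (fun j => ?_)
        h2T hE hτΨ a hC
      rcases hpos j with h | h | h
      exacts [Or.inl h, Or.inr h, Or.inl (h.trans h₁₃.symm)]
    · by_cases h₂₃ : Φ j₂ = Φ j₃
      · refine hodgeConjectureFor_of_avDominatedBy_family_of_markmanD_h2T hM6 h10 h2 i hA j₁ j₂ h23₁ h23₂ h₁₂ (fun j => ?_)
          h2T hE hτΨ a hC
        rcases hpos j with h | h | h
        exacts [Or.inl h, Or.inr h, Or.inr (h.trans h₂₃.symm)]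
      · exact hodgeConjectureFor_of_avDominatedBy_family_of_markmanT_h2T hM6 h10 h2 i hA j₁ j₂ j₃ h23₁ h23₂ h23₃ h₁₂ h₁₃ h₂₃
          hpos h2T hE hτΨ a hC

/-- **In particular: the Hodge conjecture for `∏_j A_j` itself** whenever the `(2,3)`-types `Φ_j` take at most three values
(`2`-transitive quintic part), GIVEN ONLY Markman's sixfold theorem. [cite: Markman2025SecantWeil, Thm 1.5.1] [cite: MumfordAV1970, §19] -/
theorem hodgeConjectureFor_biproduct_family_le₃_of_markmanT_h2T
    (hM6 : Markman2025_weilClasses_algebraic_hyperbolicSixfold)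
    (h10 : Module.finrank ℚ K = 10) (h2 : Module.finrank ℚ k = 2) (i : k →+* K)
    (hA : ∀ j, IsCMTypeRealisation (Φ j) (A j) (ι j) (θ j)) {τ : k →+* ℂ} (j₁ j₂ j₃ : Fin n)
    (h23₁ : (Finset.univ.filter fun s : K →+* ℂ => s.comp i = τ ∧ s ∈ (Φ j₁).1).card = 2)
    (h23₂ : (Finset.univ.filter fun s : K →+* ℂ => s.comp i = τ ∧ s ∈ (Φ j₂).1).card = 2)
    (h23₃ : (Finset.univ.filter fun s : K →+* ℂ => s.comp i = τ ∧ s ∈ (Φ j₃).1).card = 2)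
    (hpos : ∀ j, Φ j = Φ j₁ ∨ Φ j = Φ j₂ ∨ Φ j = Φ j₃)
    (h2T : ∀ x y : Fin 2 ↪ {s : K →+* ℂ // s.comp i = τ}, ∃ ρ : ℂ ≃+* ℂ, ∀ l : Fin 2, (ρ : ℂ →+* ℂ).comp (x l).1 = (y l).1)
    (hE : IsCMTypeRealisation Ψ E ιE θE) (hτΨ : τ ∈ Ψ.1) :
    HodgeConjectureFor (⨁ A).dim (⨁ A).X :=
  hodgeConjectureFor_of_avDominatedBy_family_le₃_of_markmanT_h2T hM6 h10 h2 i hA j₁ j₂ j₃ h23₁ h23₂ h23₃ hpos h2T hE hτΨ 0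
    (C := ⨁ A) ⟨AbelianVariety.prodLift 0 (𝟙 _), AbelianVariety.snd _ _, 1, one_ne_zero, by
      rw [AbelianVariety.prodLift_snd, one_smul]⟩

end Main

end Summit.HodgeConjecture.CorCM.DecicWeil23Triple

end
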